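import Literature.MathematicalPhysics.QuantumFieldTheory.Balaban1983to89.B4Lemma21Region
import Literature.MathematicalPhysics.QuantumFieldTheory.Balaban1983to89.B4Cor23ZeroDelta

/-!
# [B4] Corollary 2.3, the `δG_k(Ω,Ω₀,A)` clause at `A ≠ 0` — I: the algebra of nested regions

[B4] = T. Bałaban, «Regularity and decay of lattice Green's functions», Comm. Math. Phys. **89** (1983) 571–597
[cite: Balaban1983RegularityDecay].  For finite unions of unit blocks `Ω ⊂ Ω₀` (fine regions
`fineDom n Ωc ⊆ fineDom n Ω₀c` over label sets `Ωc ⊆ Ω₀c`, lattice units, `η = 1/n`) and a vector field in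
component form `A_ν(x)`, p. 573 (1.11) defines «δG_k(Ω,Ω₀,A) = G_k(Ω,A) − G_k(Ω₀,A)» (configurations on `Ω`
extended by zero, the result read on `Ω`), and Corollary 2.3 (p. 581) ends: «The same inequalities hold for
δG_k(Ω,Ω₀,A) with the additional factor e^{−δ₀(dist(supp f,Ω^c) + dist(supp f',Ω^c))}».  This module is the
first of two certifying that clause at `A ≠ 0` on the carriers of `B4Lemma21Region` (the operator (1.6)
`regionOp` = `−Δ^{η,N}_{A,Ω} + m² + a_kP_k(A)` and the covariant derivatives `regionDeriv`); it contains the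
EXACT ALGEBRA, the second (`B4Cor23RegionDelta`) the estimates.

## Contents (all kernel-checked, no `sorry`, standard axioms)

* §1 `extV`/`resV`: extension by zero / restriction of `R^N`-valued configurations for nested regions, the
  reindexing `sum_eq_sum_incl`, `⟨ext u, U⟩ = ⟨u, U|_Ω⟩`, block operators on extensions.
* §2 AGREEMENT OF THE DATA OF (1.3)–(1.5) ON `Ω`: the link variables `U(eηA_b)` (`fieldLink_incl`), the Neumann
  bond weights (`regWt_incl`), the block weights (`rBlkWt_incl`) and the block transporters `U(A(Γ_{y,x}))` along the
  staircases inside the blocks (`contourTrans_incl`, via `transport_fieldLink` and `lsum_pmap_val`) of `Ω` are those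
  of `Ω₀`; Neumann weights of `Ω₀` from outside `Ω` only reach the BOUNDARY LAYER `bdR Ω Ω₀` (the sites of `Ω` with
  a nearest neighbour in `Ω₀∖Ω`, `B4Cor23ZeroDelta.bdR`).
* §3 **`H_k(Ω₀,A)(ext v) = ext(H_k(Ω,A)v)` for `v` vanishing on the boundary layer** (`regionOp_extV`; the
  Laplacian part `covLap_extV` needs the vanishing, the averaging part `projOp_extV` holds for all `v`), from the
  block kernels `covLap_eq_blockOp`/`projOp_eq_blockOp` of `B4GaugeCovariance`.
* §4 **THE CUTOFF REPRESENTATION** (`dGv_eq_cutoff`): with `δG g := G_k(Ω,A)g − (G_k(Ω₀,A) ext g)|_Ω` (`dGv`), for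
  ANY site function `θ` equal to `1` on the boundary layer, `u = G_k(Ω,A)g`, `w = θu` (`smulF`):
  `δG g = w − (G_k(Ω₀,A) ext[H_k(Ω,A)w])|_Ω`, both operators coercive (so that `G = H⁻¹` inverts `H`;
  `B4Lemma21Region.mulVec_inv_mulVec`, `inv_mulVec_mulVec`).  In the sequel `θ = 1 − χ` with the Lipschitz cutoff
  `χ` of `B4Cor23ZeroDelta` (`= 0` on the boundary layer, `= 1` at distance `> 2` from `Ω₀∖Ω`), so that `w` lives
  in a unit collar at `Ω₀∖Ω` — the source of the extra factor `exp(−δ₀ dist(supp f′, Ω₀∖Ω))`.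
* §5 THE TWO COVARIANT DERIVATIVES: `D^{η,Ω}_{A,μ}(Z|_Ω)` and `D^{η,Ω₀}_{A,μ}Z` agree at the bonds of `Ω`
  (`fld_covDeriv_resV_of_mem`), `|D^Ω(Z|_Ω)(x)|² ≤ |D^{Ω₀}Z(x)|²` sitewise, and the DERIVATIVE-EXCHANGE identities
  `⟨f, D^Ω_μ(Z|_Ω)⟩ = ⟨ext(offL f), D^{Ω₀}_μ Z⟩`, `⟨Z, ext(D^{Ω*}_ν g)⟩ = ⟨Z, D^{Ω₀*}_ν ext(offL g)⟩`, where `offL`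
  zeroes a configuration at the starting points of the bonds `⟨x, x+ηe_μ⟩` leaving `Ω` inside `Ω₀` (norm and
  support do not increase: `offL_dot_self_le`, `offL_eq_zero_of`).
* §6 symmetry of (1.6) (`regionOp_transpose`, `green_transpose`, `dot_green_mulVec`), the specialisations of §5 to
  `regionDeriv`, and the PAIRING FORM of §4:
  `⟨f, δG g⟩ = ⟨f, w⟩ − ⟨(G_k(Ω₀,A) ext f)|_Ω, H_k(Ω,A)w⟩` (`dot_dGv_eq_cutoff`).

## Dictionary and honest scope

* Counting (`ℓ²`) pairings and lattice units throughout, as in `B4Lemma21Region`/`B4Cor23Region` (DICTIONARY: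
  the printed `η`-weighted pairings differ by the common factor `η^{d+1}` on both sides of every inequality of
  Corollary 2.3).  `G_k(Ω₀,A)` restricted to `Ω` is `g ↦ (G_k(Ω₀,A) ext g)|_Ω` (`resV ∘ G₀ ∘ extV`), which is
  (1.11) read as an operator on configurations on `Ω`.
* Nothing here is an estimate: the module records identities valid for every field `A`, charge `e`, `m²`, `a`,
  and every pair of nested label sets; coercivity of the two operators (1.6) is the only hypothesis of §4/§6 and
  is supplied in the sequel by `B4Lemma21Region.regionOp_form_ge` under the printed regularity hypothesis (1.7).
* No step of the manuscript under audit is used as a hypothesis; the statements are folklore linear algebra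
  about the published definitions (1.3)–(1.6), (1.11) of [B4].
* Value = kernel certificate of bookkeeping identities behind a published (1983) lemma-level statement — part of
  the cell's audit of [B4] §2, NOT summit progress (no statement about the continuum / infinite-volume limit, the
  mass gap, or `Summit.QuantumFields` is made or approached).

v1.1 (DOCFIX, 2026-08-19, self-audit of every «» unit against transcript-B4.md; the XREADs of this module were clean):
glyph-level normalisation inside quotation units only (prime `f'` as printed, `e^{…}` as printed, «Ω and A are as in
Proposition I.2.1» with its verb); no Lean statement or proof changed.
-/

namespace Literature.MathematicalPhysics.QuantumFieldTheory.Balaban1983to89.B4Cor23RegionDeltaAlg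

open Matrix Finset
open Literature.MathematicalPhysics.QuantumFieldTheory.Balaban1983to89.B4GaugeCovariance
open Literature.MathematicalPhysics.QuantumFieldTheory.Balaban1983to89.B4Lower18Regular
  (orth_dotProduct_mulVec_self dotProduct_eq_sum_fld transport_fieldLink e1 dotProduct_self_nonneg' lsum)
open Literature.MathematicalPhysics.QuantumFieldTheory.Balaban1983to89.B4TwoRegion120 (incl incl_val incl_injective)
open Literature.MathematicalPhysics.QuantumFieldTheory.Balaban1983to89.B4Reflection242 (nbrs nbrs_comm blk)
open Literature.MathematicalPhysics.QuantumFieldTheory.Balaban1983to89.B4Lower18 (fineDom mem_fineDom edistR)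
open Literature.MathematicalPhysics.QuantumFieldTheory.Balaban1983to89.B4Lower18RegularRegion
  (regWt rBlkWt rbaseEmb rstairContour compField)
open Literature.MathematicalPhysics.QuantumFieldTheory.Balaban1983to89.B4Lemma21Region
  (regionOp regionDeriv covDeriv mulVec_inv_mulVec fld_covDeriv_mulVec_of_mem fld_covDeriv_mulVec_of_not_mem
    regionOp_form_ge)
open Literature.MathematicalPhysics.QuantumFieldTheory.Balaban1983to89.B4Cor23ZeroDelta (bdR mem_bdR)

noncomputable section

/-! ## §1  Nested regions: extension by zero and restriction of `R^N`-valued configurations -/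

section Nested

variable {d : ℕ} {ι : Type*} {R R₀ : Finset (Fin (d + 1) → ℤ)}

/-- EXTENSION BY ZERO of an `R^N`-valued configuration from `Ω` to `Ω₀ ⊇ Ω` ([B4] p. 573: `G_k(Ω₀,A)` applied to
configurations «defined on Ω»). [cite: Balaban1983RegularityDecay, p. 573 (1.11), dictionary] -/
def extV (R₀ : Finset (Fin (d + 1) → ℤ)) (u : ↥R × ι → ℝ) (j : ↥R₀ × ι) : ℝ :=
  if hj : j.1.1 ∈ R then u (⟨j.1.1, hj⟩, j.2) else 0

/-- RESTRICTION of a configuration on `Ω₀` to `Ω ⊆ Ω₀`. [cite: Balaban1983RegularityDecay, p. 573 (1.11), dictionary] -/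
def resV (h : R ⊆ R₀) (U : ↥R₀ × ι → ℝ) (j : ↥R × ι) : ℝ := U (incl h j.1, j.2)

/-- the extension agrees with the configuration on `Ω`. [folklore] -/
theorem extV_incl (h : R ⊆ R₀) (u : ↥R × ι → ℝ) (x : ↥R) (i : ι) : extV R₀ u (incl h x, i) = u (x, i) := by
  unfold extV
  rw [dif_pos (by exact x.2)]
  rfl

/-- the extension vanishes off `Ω`. [folklore] -/
theorem extV_of_not_mem (u : ↥R × ι → ℝ) (j : ↥R₀ × ι) (hj : j.1.1 ∉ R) : extV R₀ u j = 0 := by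
  unfold extV; rw [dif_neg hj]

/-- block values of the extension on `Ω`. [folklore] -/
theorem fld_extV_incl (h : R ⊆ R₀) (u : ↥R × ι → ℝ) (x : ↥R) : fld (extV R₀ u) (incl h x) = fld u x := by
  funext i; exact extV_incl h u x i

/-- block values of the extension at a point of `Ω` presented as a point of `Ω₀`. [folklore] -/
theorem fld_extV_of_mem (u : ↥R × ι → ℝ) (z : ↥R₀) (hz : z.1 ∈ R) : fld (extV R₀ u) z = fld u ⟨z.1, hz⟩ := by
  funext i
  show extV R₀ u (z, i) = _
  unfold extV
  rw [dif_pos hz]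
  rfl

/-- block values of the extension off `Ω` vanish. [folklore] -/
theorem fld_extV_of_not_mem (u : ↥R × ι → ℝ) (z : ↥R₀) (hz : z.1 ∉ R) : fld (extV R₀ u) z = 0 := by
  funext i; exact extV_of_not_mem u (z, i) hz

/-- block values of the restriction. [folklore] -/
theorem fld_resV (h : R ⊆ R₀) (U : ↥R₀ × ι → ℝ) (x : ↥R) : fld (resV h U) x = fld U (incl h x) := rfl

/-- restriction after extension is the identity. [folklore] -/
theorem resV_extV (h : R ⊆ R₀) (u : ↥R × ι → ℝ) : resV h (extV R₀ u) = u := by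
  funext j
  obtain ⟨x, i⟩ := j
  exact extV_incl h u x i

/-- the extension is additive. [folklore] -/
theorem extV_add (u v : ↥R × ι → ℝ) : extV R₀ (u + v) = extV R₀ u + extV R₀ v := by
  funext j
  simp only [Pi.add_apply]
  unfold extV
  split_ifs <;> simp

/-- the extension is compatible with subtraction. [folklore] -/
theorem extV_sub (u v : ↥R × ι → ℝ) : extV R₀ (u - v) = extV R₀ u - extV R₀ v := by
  funext j
  simp only [Pi.sub_apply]
  unfold extV
  split_ifs <;> simp

/-- the restriction is additive. [folklore] -/
theorem resV_add (h : R ⊆ R₀) (U V : ↥R₀ × ι → ℝ) : resV h (U + V) = resV h U + resV h V := rfl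

/-- the restriction is compatible with subtraction. [folklore] -/
theorem resV_sub (h : R ⊆ R₀) (U V : ↥R₀ × ι → ℝ) : resV h (U - V) = resV h U - resV h V := rfl

/-- **REINDEXING**: a sum over `Ω₀` of a quantity vanishing off `Ω` is a sum over `Ω`. [folklore] -/
theorem sum_eq_sum_incl {M : Type*} [AddCommMonoid M] (h : R ⊆ R₀) (F : ↥R₀ → M)
    (hF : ∀ z : ↥R₀, z.1 ∉ R → F z = 0) : ∑ z, F z = ∑ x : ↥R, F (incl h x) := by
  classical
  have h1 : ∑ x : ↥R, F (incl h x) = ∑ z ∈ (Finset.univ : Finset ↥R).map ⟨incl h, incl_injective h⟩, F z := by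
    rw [Finset.sum_map]; rfl
  rw [h1]
  symm
  refine Finset.sum_subset (Finset.subset_univ _) fun z _ hz => hF z ?_
  intro hzR
  apply hz
  rw [Finset.mem_map]
  exact ⟨⟨z.1, hzR⟩, Finset.mem_univ _, Subtype.ext rfl⟩

/-- `fld` is additive. [folklore] -/
theorem fld_add' {X : Type*} (Φ Ψ : X × ι → ℝ) (x : X) : fld (Φ + Ψ) x = fld Φ x + fld Ψ x := rfl

/-- `fld` commutes with scalars. [folklore] -/
theorem fld_smul' {X : Type*} (r : ℝ) (Φ : X × ι → ℝ) (x : X) : fld (r • Φ) x = r • fld Φ x := rfl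

/-- the extension commutes with scalars. [folklore] -/
theorem extV_smul (r : ℝ) (u : ↥R × ι → ℝ) : extV R₀ (r • u) = r • extV R₀ u := by
  funext j
  simp only [Pi.smul_apply]
  unfold extV
  split_ifs <;> simp

/-- two configurations agree iff their block values agree. [folklore] -/
theorem ext_of_fld {X : Type*} {Φ Ψ : X × ι → ℝ} (h : ∀ x, fld Φ x = fld Ψ x) : Φ = Ψ := by
  funext j
  obtain ⟨x, i⟩ := j
  exact congrFun (h x) i

variable [Fintype ι]

/-- `⟨ext u, U⟩_{Ω₀} = ⟨u, U|_Ω⟩_Ω`. [folklore] -/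
theorem extV_dotProduct (h : R ⊆ R₀) (u : ↥R × ι → ℝ) (U : ↥R₀ × ι → ℝ) :
    extV R₀ u ⬝ᵥ U = u ⬝ᵥ resV h U := by
  rw [dotProduct_eq_sum_fld, dotProduct_eq_sum_fld,
    sum_eq_sum_incl h (fun z => fld (extV R₀ u) z ⬝ᵥ fld U z) fun z hz => by
      rw [fld_extV_of_not_mem u z hz, zero_dotProduct]]
  refine Finset.sum_congr rfl fun x _ => ?_
  rw [fld_extV_incl, fld_resV]

/-- `⟨U, ext u⟩_{Ω₀} = ⟨U|_Ω, u⟩_Ω`. [folklore] -/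
theorem dotProduct_extV (h : R ⊆ R₀) (U : ↥R₀ × ι → ℝ) (u : ↥R × ι → ℝ) :
    U ⬝ᵥ extV R₀ u = resV h U ⬝ᵥ u := by
  rw [dotProduct_comm, extV_dotProduct h, dotProduct_comm]

/-- `‖ext u‖² = ‖u‖²`. [folklore] -/
theorem extV_dotProduct_extV (h : R ⊆ R₀) (u v : ↥R × ι → ℝ) : extV R₀ u ⬝ᵥ extV R₀ v = u ⬝ᵥ v := by
  rw [extV_dotProduct h, resV_extV]

/-- a block operator of `Ω₀` applied to an extension by zero, read at any point. [folklore] -/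
theorem fld_blockOp_mulVec_extV (h : R ⊆ R₀) (K : ↥R₀ → ↥R₀ → Matrix ι ι ℝ) (u : ↥R × ι → ℝ) (z : ↥R₀) :
    fld (blockOp K *ᵥ extV R₀ u) z = ∑ x : ↥R, K z (incl h x) *ᵥ fld u x := by
  rw [fld_blockOp_mulVec, sum_eq_sum_incl h (fun z' => K z z' *ᵥ fld (extV R₀ u) z') fun z' hz' => by
    rw [fld_extV_of_not_mem u z' hz', Matrix.mulVec_zero]]
  refine Finset.sum_congr rfl fun x _ => ?_
  rw [fld_extV_incl]

end Nested

/-! ## §2  The transporters and link variables of `Ω` are those of `Ω₀` on the blocks of `Ω` -/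

section Agree

variable {d : ℕ} {ι : Type*} [Fintype ι] [DecidableEq ι]

/-- the summed bond field along a contour of subtype points is that of the underlying contour. [folklore] -/
theorem lsum_pmap_val {X : Type*} {P : X → Prop} (B : X → X → ℝ) (l : List X) (p : X) (hp : P p)
    (hl : ∀ z ∈ l, P z) :
    lsum (fun u v : Subtype P => B u.1 v.1) ⟨p, hp⟩ (l.pmap Subtype.mk hl) = lsum B p l := by
  induction l generalizing p with
  | nil => rfl
  | cons a l ih =>
    show B p a + lsum (fun u v : Subtype P => B u.1 v.1) ⟨a, hl a (by simp)⟩ (l.pmap Subtype.mk _) = B p a + lsum B a l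
    rw [ih a (hl a (by simp))]

/-- `fineDom` is monotone in the label set. [folklore] -/
theorem fineDom_mono {n : ℕ} (hn : 1 ≤ n) {Ωc Ω₀c : Finset (Fin (d + 1) → ℤ)} (hΩ : Ωc ⊆ Ω₀c) :
    fineDom n Ωc ⊆ fineDom n Ω₀c := fun x hx => by
  rw [mem_fineDom hn] at hx ⊢
  exact hΩ hx

variable (F : OrthFlow ι) (κ : ℝ) {n : ℕ} (hn : 1 ≤ n) {Ωc Ω₀c : Finset (Fin (d + 1) → ℤ)} (hΩ : Ωc ⊆ Ω₀c)
  (Ac : (Fin (d + 1) → ℤ) → Fin (d + 1) → ℝ)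

/-- **THE LINK VARIABLES AGREE**: `U(eηA_b)` for a bond `b ⊂ Ω` is the same matrix whether `b` is regarded as a
bond of `Ω` or of `Ω₀`. [cite: Balaban1983RegularityDecay, p. 572 (1.3)] -/
theorem fieldLink_incl (x y : ↥(fineDom n Ωc)) :
    fieldLink F κ (fun u v : ↥(fineDom n Ω₀c) => compField Ac u.1 v.1) (incl (fineDom_mono hn hΩ) x)
        (incl (fineDom_mono hn hΩ) y)
      = fieldLink F κ (fun u v : ↥(fineDom n Ωc) => compField Ac u.1 v.1) x y := rfl

/-- **THE NEUMANN BOND WEIGHTS AGREE** on pairs of points of `Ω`. [cite: Balaban1983RegularityDecay, p. 572 (1.3)] -/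
theorem regWt_incl (x y : ↥(fineDom n Ωc)) :
    regWt n (fineDom n Ω₀c) (incl (fineDom_mono hn hΩ) x) (incl (fineDom_mono hn hΩ) y)
      = regWt n (fineDom n Ωc) x y := rfl

/-- **THE BLOCK TRANSPORTERS AGREE**: for a unit label `y ∈ Ω` and a fine point `x ∈ Ω`, the transporter
`U(A(Γ_{y,x}))` along the block staircase is the same in `Ω` and in `Ω₀` (the staircase lies in `B(y) ⊂ Ω`).
[cite: Balaban1983RegularityDecay, p. 572 (1.4) «Γ^{(k)}_{y,x}»] -/
theorem contourTrans_incl (y : ↥Ωc) (x : ↥(fineDom n Ωc)) :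
    contourTrans (fieldLink F κ (fun u v : ↥(fineDom n Ω₀c) => compField Ac u.1 v.1)) (rbaseEmb hn Ω₀c)
        (rstairContour hn Ω₀c) (incl hΩ y) (incl (fineDom_mono hn hΩ) x)
      = contourTrans (fieldLink F κ (fun u v : ↥(fineDom n Ωc) => compField Ac u.1 v.1)) (rbaseEmb hn Ωc)
        (rstairContour hn Ωc) y x := by
  unfold contourTrans
  rw [transport_fieldLink, transport_fieldLink]
  congr 2
  unfold rstairContour
  by_cases hb : blk n x.1 = y.1
  · have hb₀ : blk n (incl (fineDom_mono hn hΩ) x).1 = (incl hΩ y).1 := hb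
    rw [dif_pos hb₀, dif_pos hb]
    unfold rbaseEmb
    rw [lsum_pmap_val (fun u v => compField Ac u v), lsum_pmap_val (fun u v => compField Ac u v)]
    rfl
  · have hb₀ : ¬ blk n (incl (fineDom_mono hn hΩ) x).1 = (incl hΩ y).1 := hb
    rw [dif_neg hb₀, dif_neg hb]
    rfl

/-- the block weights agree. [cite: Balaban1983RegularityDecay, p. 572 (1.4)] -/
theorem rBlkWt_incl (y : ↥Ωc) (x : ↥(fineDom n Ωc)) :
    rBlkWt n Ω₀c (fineDom n Ω₀c) (incl hΩ y) (incl (fineDom_mono hn hΩ) x) = rBlkWt n Ωc (fineDom n Ωc) y x :=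
  rfl

/-- a block weight `q(y', x)` of `Ω₀` at a point `x ∈ Ω` vanishes unless the label `y'` lies in `Ω`. [folklore] -/
theorem rBlkWt_incl_eq_zero (y' : ↥Ω₀c) (x : ↥(fineDom n Ωc)) (hy : y'.1 ∉ Ωc) :
    rBlkWt n Ω₀c (fineDom n Ω₀c) y' (incl (fineDom_mono hn hΩ) x) = 0 := by
  unfold rBlkWt
  rw [if_neg]
  intro hb
  apply hy
  have hx := x.2
  rw [mem_fineDom hn] at hx
  have : blk n (incl (fineDom_mono hn hΩ) x).1 = blk n x.1 := rfl
  rw [← hb, this]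
  exact hx

/-- a block weight product `q(y', z)q(y', x)` of `Ω₀` with `x ∈ Ω`, `z ∉ Ω` vanishes. [folklore] -/
theorem rBlkWt_mul_eq_zero (y' : ↥Ω₀c) (z : ↥(fineDom n Ω₀c)) (hz : z.1 ∉ fineDom n Ωc) (x : ↥(fineDom n Ωc)) :
    rBlkWt n Ω₀c (fineDom n Ω₀c) y' z * rBlkWt n Ω₀c (fineDom n Ω₀c) y' (incl (fineDom_mono hn hΩ) x) = 0 := by
  by_cases hy : y'.1 ∈ Ωc
  · have hzb : blk n z.1 ≠ y'.1 := by
      intro h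
      apply hz
      rw [mem_fineDom hn, h]
      exact hy
    unfold rBlkWt
    rw [if_neg hzb, zero_mul]
  · rw [rBlkWt_incl_eq_zero hn hΩ y' x hy, mul_zero]

/-- a Neumann weight `c(w, x)` of `Ω₀` with `x ∈ Ω` off the boundary layer vanishes unless `w ∈ Ω`. [folklore] -/
theorem regWt_incl_eq_zero_left (w : ↥(fineDom n Ω₀c)) (x : ↥(fineDom n Ωc))
    (hx : x ∉ bdR (fineDom n Ωc) (fineDom n Ω₀c)) (hw : w.1 ∉ fineDom n Ωc) :
    regWt n (fineDom n Ω₀c) w (incl (fineDom_mono hn hΩ) x) = 0 := by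
  unfold regWt
  rw [if_neg, mul_zero]
  intro hnb
  apply hx
  rw [mem_bdR]
  exact ⟨w.1, nbrs_comm.2 hnb, w.2, hw⟩

/-- the same for `c(x, w)`. [folklore] -/
theorem regWt_incl_eq_zero_right (x : ↥(fineDom n Ωc)) (w : ↥(fineDom n Ω₀c))
    (hx : x ∉ bdR (fineDom n Ωc) (fineDom n Ω₀c)) (hw : w.1 ∉ fineDom n Ωc) :
    regWt n (fineDom n Ω₀c) (incl (fineDom_mono hn hΩ) x) w = 0 := by
  unfold regWt
  rw [if_neg, mul_zero]
  intro hnb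
  apply hx
  rw [mem_bdR]
  exact ⟨w.1, hnb, w.2, hw⟩

end Agree

/-! ## §3  `H_k(Ω₀,A)` extends `H_k(Ω,A)` off the boundary layer

For a configuration `v` on `Ω` vanishing on the BOUNDARY LAYER `∂⁻Ω = {y ∈ Ω : y has a nearest neighbour in Ω₀∖Ω}`
(`B4Cor23ZeroDelta.bdR`), the operator (1.6) of the big region applied to the extension by zero is the extension
of the operator of the small region: `H_k(Ω₀,A)(ext v) = ext(H_k(Ω,A)v)`.  The Laplacian parts agree because no
Neumann bond of `Ω₀` leaving `Ω` sees a non-zero value; the averaging parts agree on ALL configurations because the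
blocks, block weights and block transporters of `Ω` are those of `Ω₀` (§2). -/

section Extend

variable {d : ℕ} {ι : Type*} [Fintype ι] [DecidableEq ι]

variable (F : OrthFlow ι) (e : ℝ) {n : ℕ} (hn : 1 ≤ n) (a m2 : ℝ) {Ωc Ω₀c : Finset (Fin (d + 1) → ℤ)}
  (hΩ : Ωc ⊆ Ω₀c) (Ac : (Fin (d + 1) → ℤ) → Fin (d + 1) → ℝ)

/-- THE LINK VARIABLES `U(eηA_b)` of the region over `Ωc` (abbreviation). [cite: Balaban1983RegularityDecay, p. 572 (1.3)] -/
noncomputable abbrev lnk (F : OrthFlow ι) (e : ℝ) (n : ℕ) (Ωc : Finset (Fin (d + 1) → ℤ))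
    (Ac : (Fin (d + 1) → ℤ) → Fin (d + 1) → ℝ) : ↥(fineDom n Ωc) → ↥(fineDom n Ωc) → Matrix ι ι ℝ :=
  fieldLink F (e / n) fun u v => compField Ac u.1 v.1

/-- THE BLOCK TRANSPORTERS `U(A(Γ_{y,x}))` of the region over `Ωc` (abbreviation).
[cite: Balaban1983RegularityDecay, p. 572 (1.4)] -/
noncomputable abbrev trn (F : OrthFlow ι) (e : ℝ) {n : ℕ} (hn : 1 ≤ n) (Ωc : Finset (Fin (d + 1) → ℤ))
    (Ac : (Fin (d + 1) → ℤ) → Fin (d + 1) → ℝ) : ↥Ωc → ↥(fineDom n Ωc) → Matrix ι ι ℝ :=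
  contourTrans (lnk F e n Ωc Ac) (rbaseEmb hn Ωc) (rstairContour hn Ωc)

/-- the operator (1.6) of the region, unfolded. [cite: Balaban1983RegularityDecay, p. 572 (1.6)] -/
theorem regionOp_eq (Ωc : Finset (Fin (d + 1) → ℤ)) :
    regionOp F e hn a m2 Ωc Ac
      = covLap (regWt n (fineDom n Ωc)) (lnk F e n Ωc Ac) + m2 • (1 : Matrix _ _ ℝ)
        + (a * ((n : ℝ) ^ (d + 1))⁻¹) • projOp (rBlkWt n Ωc (fineDom n Ωc)) (trn F e hn Ωc Ac) := rfl

/-- the Laplacian kernels of `Ω₀` and `Ω` agree at pairs of points of `Ω`, the second off the boundary layer.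
[folklore] -/
theorem covLapKer_incl (x₀ x : ↥(fineDom n Ωc)) (hx : x ∉ bdR (fineDom n Ωc) (fineDom n Ω₀c)) :
    covLapKer (regWt n (fineDom n Ω₀c)) (lnk F e n Ω₀c Ac) (incl (fineDom_mono hn hΩ) x₀)
        (incl (fineDom_mono hn hΩ) x)
      = covLapKer (regWt n (fineDom n Ωc)) (lnk F e n Ωc Ac) x₀ x := by
  have hR := fineDom_mono hn hΩ
  unfold covLapKer
  by_cases h : x₀ = x
  · subst h
    rw [if_pos rfl, if_pos rfl, if_pos rfl, if_pos rfl,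
      sum_eq_sum_incl hR (fun w => regWt n (fineDom n Ω₀c) w (incl hR x₀)
        • ((lnk F e n Ω₀c Ac w (incl hR x₀))ᵀ * lnk F e n Ω₀c Ac w (incl hR x₀))) fun w hw => by
          rw [regWt_incl_eq_zero_left hn hΩ w x₀ hx hw, zero_smul],
      sum_eq_sum_incl hR (fun y => regWt n (fineDom n Ω₀c) (incl hR x₀) y • (1 : Matrix ι ι ℝ)) fun w hw => by
          rw [regWt_incl_eq_zero_right hn hΩ x₀ w hx hw, zero_smul]]
    rfl
  · have h' : incl hR x₀ ≠ incl hR x := fun h'' => h (incl_injective hR h'')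
    rw [if_neg h, if_neg h, if_neg h', if_neg h']
    rfl

/-- the Laplacian kernel of `Ω₀` from a point outside `Ω` to a point of `Ω` off the boundary layer vanishes.
[folklore] -/
theorem covLapKer_out (z : ↥(fineDom n Ω₀c)) (hz : z.1 ∉ fineDom n Ωc) (x : ↥(fineDom n Ωc))
    (hx : x ∉ bdR (fineDom n Ωc) (fineDom n Ω₀c)) :
    covLapKer (regWt n (fineDom n Ω₀c)) (lnk F e n Ω₀c Ac) z (incl (fineDom_mono hn hΩ) x) = 0 := by
  have hne : z ≠ incl (fineDom_mono hn hΩ) x := fun h => hz (by rw [h]; exact x.2)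
  unfold covLapKer
  rw [if_neg hne, if_neg hne, regWt_incl_eq_zero_right hn hΩ x z hx hz, regWt_incl_eq_zero_left hn hΩ z x hx hz]
  simp

include hn hΩ in
/-- **THE LAPLACIAN PART**: `−Δ^{η,N}_{A,Ω₀}(ext v) = ext(−Δ^{η,N}_{A,Ω}v)` for `v` vanishing on the boundary
layer. [cite: Balaban1983RegularityDecay, p. 572 (1.3)] -/
theorem covLap_extV (v : ↥(fineDom n Ωc) × ι → ℝ)
    (hv : ∀ x ∈ bdR (fineDom n Ωc) (fineDom n Ω₀c), fld v x = 0) :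
    covLap (regWt n (fineDom n Ω₀c)) (lnk F e n Ω₀c Ac) *ᵥ extV (fineDom n Ω₀c) v
      = extV (fineDom n Ω₀c) (covLap (regWt n (fineDom n Ωc)) (lnk F e n Ωc Ac) *ᵥ v) := by
  have hR := fineDom_mono hn hΩ
  refine ext_of_fld fun z => ?_
  rw [covLap_eq_blockOp, covLap_eq_blockOp, fld_blockOp_mulVec_extV hR]
  by_cases hz : z.1 ∈ fineDom n Ωc
  · obtain ⟨x₀, rfl⟩ : ∃ x₀ : ↥(fineDom n Ωc), z = incl hR x₀ := ⟨⟨z.1, hz⟩, Subtype.ext rfl⟩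
    rw [fld_extV_incl, fld_blockOp_mulVec]
    refine Finset.sum_congr rfl fun x _ => ?_
    by_cases hx : x ∈ bdR (fineDom n Ωc) (fineDom n Ω₀c)
    · rw [hv x hx, Matrix.mulVec_zero, Matrix.mulVec_zero]
    · rw [covLapKer_incl F e hn hΩ Ac x₀ x hx]
  · rw [fld_extV_of_not_mem _ z hz]
    refine Finset.sum_eq_zero fun x _ => ?_
    by_cases hx : x ∈ bdR (fineDom n Ωc) (fineDom n Ω₀c)
    · rw [hv x hx, Matrix.mulVec_zero]
    · rw [covLapKer_out F e hn hΩ Ac z hz x hx, Matrix.zero_mulVec]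

include hΩ in
/-- **THE AVERAGING PART**: `P_k(A)` of `Ω₀` on extensions by zero is the extension of `P_k(A)` of `Ω` — on ALL
configurations (blocks, block weights and block transporters agree, §2). [cite: Balaban1983RegularityDecay, p. 572 (1.5)] -/
theorem projOp_extV (v : ↥(fineDom n Ωc) × ι → ℝ) :
    projOp (rBlkWt n Ω₀c (fineDom n Ω₀c)) (trn F e hn Ω₀c Ac) *ᵥ extV (fineDom n Ω₀c) v
      = extV (fineDom n Ω₀c) (projOp (rBlkWt n Ωc (fineDom n Ωc)) (trn F e hn Ωc Ac) *ᵥ v) := by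
  have hR := fineDom_mono hn hΩ
  refine ext_of_fld fun z => ?_
  rw [projOp_eq_blockOp, projOp_eq_blockOp, fld_blockOp_mulVec_extV hR]
  by_cases hz : z.1 ∈ fineDom n Ωc
  · obtain ⟨x₀, rfl⟩ : ∃ x₀ : ↥(fineDom n Ωc), z = incl hR x₀ := ⟨⟨z.1, hz⟩, Subtype.ext rfl⟩
    rw [fld_extV_incl, fld_blockOp_mulVec]
    refine Finset.sum_congr rfl fun x _ => ?_
    congr 1
    rw [sum_eq_sum_incl hΩ (fun y => (rBlkWt n Ω₀c (fineDom n Ω₀c) y (incl hR x₀)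
        * rBlkWt n Ω₀c (fineDom n Ω₀c) y (incl hR x)) • ((trn F e hn Ω₀c Ac y (incl hR x₀))ᵀ
        * trn F e hn Ω₀c Ac y (incl hR x))) fun y hy => by
          rw [rBlkWt_incl_eq_zero hn hΩ y x hy, mul_zero, zero_smul]]
    refine Finset.sum_congr rfl fun y _ => ?_
    rw [rBlkWt_incl hn hΩ y x₀, rBlkWt_incl hn hΩ y x]
    unfold trn lnk
    rw [contourTrans_incl F (e / n) hn hΩ Ac y x₀, contourTrans_incl F (e / n) hn hΩ Ac y x]
  · rw [fld_extV_of_not_mem _ z hz]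
    refine Finset.sum_eq_zero fun x _ => ?_
    rw [Finset.sum_eq_zero fun y _ => by rw [rBlkWt_mul_eq_zero hn hΩ y z hz x, zero_smul], Matrix.zero_mulVec]

include hΩ in
/-- **`H_k(Ω₀,A)(ext v) = ext(H_k(Ω,A)v)` FOR `v` VANISHING ON THE BOUNDARY LAYER** — the operator (1.6) of the
big region extends that of the small one.  [cite: Balaban1983RegularityDecay, p. 572 (1.6); p. 573 (1.11)] -/
theorem regionOp_extV (v : ↥(fineDom n Ωc) × ι → ℝ)
    (hv : ∀ x ∈ bdR (fineDom n Ωc) (fineDom n Ω₀c), fld v x = 0) :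
    regionOp F e hn a m2 Ω₀c Ac *ᵥ extV (fineDom n Ω₀c) v
      = extV (fineDom n Ω₀c) (regionOp F e hn a m2 Ωc Ac *ᵥ v) := by
  rw [regionOp_eq, regionOp_eq, Matrix.add_mulVec, Matrix.add_mulVec, Matrix.smul_mulVec, Matrix.smul_mulVec,
    Matrix.one_mulVec, Matrix.add_mulVec, Matrix.add_mulVec, Matrix.smul_mulVec, Matrix.smul_mulVec,
    Matrix.one_mulVec, extV_add, extV_add, extV_smul, extV_smul, covLap_extV F e hn hΩ Ac v hv,
    projOp_extV F e hn hΩ Ac v]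

end Extend

/-! ## §4  The cutoff representation of `δG_k(Ω,Ω₀,A)`

`δG_k(Ω,Ω₀,A) = G_k(Ω,A) − G_k(Ω₀,A)` ([B4] p. 573 (1.11), the second term restricted to configurations on `Ω` and
read on `Ω`).  For ANY site function `θ` on `Ω` equal to `1` on the boundary layer and `u = G_k(Ω,A)g`,
`w = θu`:  `δG_k(Ω,Ω₀,A)g = w − (G_k(Ω₀,A) ext[H_k(Ω,A)w])|_Ω` — because `u − w` vanishes on the boundary layer,
so `G_k(Ω₀,A)` inverts `H_k(Ω₀,A) ext(u − w) = ext H_k(Ω,A)(u − w) = ext(g − H_k(Ω,A)w)` (§3). -/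

section Cutoff

variable {d : ℕ} {ι : Type*} [Fintype ι] [DecidableEq ι]

/-- `H⁻¹(Hf) = f` for a coercive matrix `H`. [folklore] -/
theorem inv_mulVec_mulVec {S : Type*} [Fintype S] [DecidableEq S] {H : Matrix S S ℝ} {γ : ℝ} (hγ : 0 < γ)
    (h : ∀ v, γ * (v ⬝ᵥ v) ≤ v ⬝ᵥ (H *ᵥ v)) (f : S → ℝ) : H⁻¹ *ᵥ (H *ᵥ f) = f := by
  rw [Matrix.mulVec_mulVec, Matrix.nonsing_inv_mul _
    (Literature.MathematicalPhysics.QuantumFieldTheory.Balaban1983to89.B4Lower18Regular.isUnit_det_of_form_ge hγ h),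
    Matrix.one_mulVec]

/-- MULTIPLICATION BY A SITE FUNCTION `θ` (componentwise in `R^N`). [folklore] -/
def smulF {X : Type*} (θ : X → ℝ) (Φ : X × ι → ℝ) (j : X × ι) : ℝ := θ j.1 * Φ j

omit [Fintype ι] [DecidableEq ι] in
/-- block values of `θΦ`. [folklore] -/
theorem fld_smulF {X : Type*} (θ : X → ℝ) (Φ : X × ι → ℝ) (x : X) : fld (smulF θ Φ) x = θ x • fld Φ x := rfl

omit [Fintype ι] [DecidableEq ι] in
/-- `(1 − θ)Φ + θΦ = Φ`. [folklore] -/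
theorem smulF_one_sub_add_smulF {X : Type*} (θ : X → ℝ) (Φ : X × ι → ℝ) :
    smulF (fun x => 1 - θ x) Φ + smulF θ Φ = Φ := by
  funext j; simp only [Pi.add_apply, smulF]; ring

variable {R R₀ : Finset (Fin (d + 1) → ℤ)}

/-- **THE DIFFERENCE OF THE GREEN'S FUNCTIONS `δG_k(Ω,Ω₀,A)g = G_k(Ω,A)g − (G_k(Ω₀,A)g)|_Ω`** for a configuration
`g` on `Ω` (extended by zero to `Ω₀`), as a configuration on `Ω` — [B4] (1.11) with `Ω ⊂ Ω₀`, for general matrices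
`G` on `Ω` and `G₀` on `Ω₀`. [cite: Balaban1983RegularityDecay, p. 573 (1.11)] -/
def dGv (h : R ⊆ R₀) (G : Matrix (↥R × ι) (↥R × ι) ℝ) (G₀ : Matrix (↥R₀ × ι) (↥R₀ × ι) ℝ) (g : ↥R × ι → ℝ) :
    ↥R × ι → ℝ :=
  G *ᵥ g - resV h (G₀ *ᵥ extV R₀ g)

variable (F : OrthFlow ι) (e : ℝ) {n : ℕ} (hn : 1 ≤ n) (a m2 : ℝ) {Ωc Ω₀c : Finset (Fin (d + 1) → ℤ)}
  (hΩ : Ωc ⊆ Ω₀c) (Ac : (Fin (d + 1) → ℤ) → Fin (d + 1) → ℝ)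

include hΩ in
/-- **`(G_k(Ω₀,A) ext[H_k(Ω,A)v])|_Ω = v` FOR `v` VANISHING ON THE BOUNDARY LAYER** (`H_k(Ω₀,A)` coercive).
[cite: Balaban1983RegularityDecay, p. 572 (1.6); p. 573 (1.11)] -/
theorem resV_green₀_extV_regionOp {γ : ℝ} (hγ : 0 < γ)
    (hco₀ : ∀ v, γ * (v ⬝ᵥ v) ≤ v ⬝ᵥ (regionOp F e hn a m2 Ω₀c Ac *ᵥ v))
    (v : ↥(fineDom n Ωc) × ι → ℝ) (hv : ∀ x ∈ bdR (fineDom n Ωc) (fineDom n Ω₀c), fld v x = 0) :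
    resV (fineDom_mono hn hΩ) ((regionOp F e hn a m2 Ω₀c Ac)⁻¹
        *ᵥ extV (fineDom n Ω₀c) (regionOp F e hn a m2 Ωc Ac *ᵥ v)) = v := by
  rw [← regionOp_extV F e hn a m2 hΩ Ac v hv, inv_mulVec_mulVec hγ hco₀, resV_extV]

include hΩ in
/-- **THE CUTOFF REPRESENTATION OF `δG_k(Ω,Ω₀,A)`**: for a site function `θ` equal to `1` on the boundary layer,
`u = G_k(Ω,A)g` and `w = θu`,  `δG_k(Ω,Ω₀,A)g = w − (G_k(Ω₀,A) ext[H_k(Ω,A)w])|_Ω`  (both operators (1.6)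
coercive).  [cite: Balaban1983RegularityDecay, p. 573 (1.11); p. 581 Corollary 2.3] -/
theorem dGv_eq_cutoff {γ : ℝ} (hγ : 0 < γ)
    (hco : ∀ v, γ * (v ⬝ᵥ v) ≤ v ⬝ᵥ (regionOp F e hn a m2 Ωc Ac *ᵥ v))
    (hco₀ : ∀ v, γ * (v ⬝ᵥ v) ≤ v ⬝ᵥ (regionOp F e hn a m2 Ω₀c Ac *ᵥ v))
    (θ : ↥(fineDom n Ωc) → ℝ) (hθ : ∀ x ∈ bdR (fineDom n Ωc) (fineDom n Ω₀c), θ x = 1)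
    (g : ↥(fineDom n Ωc) × ι → ℝ) :
    dGv (fineDom_mono hn hΩ) (regionOp F e hn a m2 Ωc Ac)⁻¹ (regionOp F e hn a m2 Ω₀c Ac)⁻¹ g
      = smulF θ ((regionOp F e hn a m2 Ωc Ac)⁻¹ *ᵥ g)
        - resV (fineDom_mono hn hΩ) ((regionOp F e hn a m2 Ω₀c Ac)⁻¹ *ᵥ extV (fineDom n Ω₀c)
            (regionOp F e hn a m2 Ωc Ac *ᵥ smulF θ ((regionOp F e hn a m2 Ωc Ac)⁻¹ *ᵥ g))) := by
  have hR := fineDom_mono hn hΩ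
  -- `u − w = (1 − θ)u` vanishes on the boundary layer
  have hvan : ∀ x ∈ bdR (fineDom n Ωc) (fineDom n Ω₀c),
      fld (smulF (fun x => 1 - θ x) ((regionOp F e hn a m2 Ωc Ac)⁻¹ *ᵥ g)) x = 0 := by
    intro x hx
    rw [fld_smulF, hθ x hx, sub_self, zero_smul]
  have hkey := resV_green₀_extV_regionOp F e hn a m2 hΩ Ac hγ hco₀ _ hvan
  have hone := smulF_one_sub_add_smulF θ ((regionOp F e hn a m2 Ωc Ac)⁻¹ *ᵥ g)
  -- `H(1 − θ)u = g − Hw`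
  have hsplit : regionOp F e hn a m2 Ωc Ac *ᵥ smulF (fun x => 1 - θ x) ((regionOp F e hn a m2 Ωc Ac)⁻¹ *ᵥ g)
      = g - regionOp F e hn a m2 Ωc Ac *ᵥ smulF θ ((regionOp F e hn a m2 Ωc Ac)⁻¹ *ᵥ g) := by
    rw [eq_sub_iff_add_eq, ← Matrix.mulVec_add, hone, mulVec_inv_mulVec hγ hco]
  rw [hsplit, extV_sub, Matrix.mulVec_sub, resV_sub] at hkey
  -- `(1 − θ)u = u − w`
  have hu : smulF (fun x => 1 - θ x) ((regionOp F e hn a m2 Ωc Ac)⁻¹ *ᵥ g)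
      = (regionOp F e hn a m2 Ωc Ac)⁻¹ *ᵥ g - smulF θ ((regionOp F e hn a m2 Ωc Ac)⁻¹ *ᵥ g) := by
    rw [eq_sub_iff_add_eq, hone]
  rw [hu] at hkey
  have hk' : resV hR ((regionOp F e hn a m2 Ω₀c Ac)⁻¹ *ᵥ extV (fineDom n Ω₀c) g)
      = ((regionOp F e hn a m2 Ωc Ac)⁻¹ *ᵥ g - smulF θ ((regionOp F e hn a m2 Ωc Ac)⁻¹ *ᵥ g))
        + resV hR ((regionOp F e hn a m2 Ω₀c Ac)⁻¹ *ᵥ extV (fineDom n Ω₀c)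
            (regionOp F e hn a m2 Ωc Ac *ᵥ smulF θ ((regionOp F e hn a m2 Ωc Ac)⁻¹ *ᵥ g))) := by
    rw [← hkey, sub_add_cancel]
  unfold dGv
  rw [hk']
  abel

end Cutoff

/-! ## §5  The covariant derivatives of `Ω` and `Ω₀`

`D^η_{A,μ}` on `Ω` (Neumann: only bonds inside `Ω`) and on `Ω₀` agree at the bonds of `Ω`; the bonds
`⟨x, x + ηe_μ⟩` with `x ∈ Ω`, `x + ηe_μ ∈ Ω₀∖Ω` are seen by `Ω₀` only.  Zeroing a test configuration at the
starting points of these bonds (`offL`) exchanges the two derivatives in pairings. -/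

section Deriv

variable {d : ℕ} {ι : Type*} [Fintype ι] [DecidableEq ι] {R R₀ : Finset (Fin (d + 1) → ℤ)}

/-- ZEROING a configuration on `Ω` at the sites `x` whose bond `⟨x, x + e_μ⟩` leaves `Ω` inside `Ω₀`. [folklore] -/
def offL (R₀ : Finset (Fin (d + 1) → ℤ)) (μ : Fin (d + 1)) (f : ↥R × ι → ℝ) (j : ↥R × ι) : ℝ :=
  if j.1.1 + e1 μ ∈ R₀ ∧ j.1.1 + e1 μ ∉ R then 0 else f j

omit [Fintype ι] [DecidableEq ι] in
/-- block values of `offL` at a zeroed site. [folklore] -/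
theorem fld_offL_of_mem (μ : Fin (d + 1)) (f : ↥R × ι → ℝ) (x : ↥R) (h₀ : x.1 + e1 μ ∈ R₀)
    (h : x.1 + e1 μ ∉ R) : fld (offL R₀ μ f) x = 0 := by
  funext i
  show offL R₀ μ f (x, i) = 0
  unfold offL
  rw [if_pos ⟨h₀, h⟩]

omit [Fintype ι] [DecidableEq ι] in
/-- block values of `offL` elsewhere. [folklore] -/
theorem fld_offL_of_not (μ : Fin (d + 1)) (f : ↥R × ι → ℝ) (x : ↥R) (h : ¬ (x.1 + e1 μ ∈ R₀ ∧ x.1 + e1 μ ∉ R)) :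
    fld (offL R₀ μ f) x = fld f x := by
  funext i
  show offL R₀ μ f (x, i) = f (x, i)
  unfold offL
  rw [if_neg h]

omit [Fintype ι] [DecidableEq ι] in
/-- `|offL f (j)| ≤ |f j|` entrywise. [folklore] -/
theorem offL_sq_le (μ : Fin (d + 1)) (f : ↥R × ι → ℝ) (j : ↥R × ι) : offL R₀ μ f j ^ 2 ≤ f j ^ 2 := by
  unfold offL; split_ifs
  · rw [zero_pow two_ne_zero]; exact sq_nonneg _
  · exact le_rfl

omit [DecidableEq ι] in
/-- `‖offL f‖² ≤ ‖f‖²`. [folklore] -/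
theorem offL_dot_self_le (μ : Fin (d + 1)) (f : ↥R × ι → ℝ) :
    offL R₀ μ f ⬝ᵥ offL R₀ μ f ≤ f ⬝ᵥ f := by
  unfold dotProduct
  refine Finset.sum_le_sum fun j _ => ?_
  rw [← sq, ← sq]
  exact offL_sq_le μ f j

omit [Fintype ι] [DecidableEq ι] in
/-- `offL f` vanishes wherever `f` does. [folklore] -/
theorem offL_eq_zero_of (μ : Fin (d + 1)) (f : ↥R × ι → ℝ) (j : ↥R × ι) (h : f j = 0) : offL R₀ μ f j = 0 := by
  unfold offL; split_ifs
  · rfl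
  · exact h

/-- a zeroed site lies on the boundary layer. [folklore] -/
theorem mem_bdR_of_offL {μ : Fin (d + 1)} {x : ↥R} (h₀ : x.1 + e1 μ ∈ R₀) (h : x.1 + e1 μ ∉ R) :
    x ∈ bdR R R₀ := by
  rw [mem_bdR]
  refine ⟨x.1 + e1 μ, ?_, h₀, h⟩
  rw [Literature.MathematicalPhysics.QuantumFieldTheory.Balaban1983to89.B4Reflection242.mem_nbrs]
  exact ⟨μ, Or.inl rfl⟩

variable (n : ℕ) (h : R ⊆ R₀) (W₀ : ↥R₀ → ↥R₀ → Matrix ι ι ℝ) (W : ↥R → ↥R → Matrix ι ι ℝ)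
  (hW : ∀ x y : ↥R, W₀ (incl h x) (incl h y) = W x y)

include hW in
/-- **THE DERIVATIVES AGREE AT THE BONDS OF `Ω`**: `(D^Ω_μ (Z|_Ω))(x) = (D^{Ω₀}_μ Z)(x)` when `x + e_μ ∈ Ω`.
[cite: Balaban1983RegularityDecay, p. 572 (1.3)] -/
theorem fld_covDeriv_resV_of_mem (μ : Fin (d + 1)) (Z : ↥R₀ × ι → ℝ) (x : ↥R) (hx : x.1 + e1 μ ∈ R) :
    fld (covDeriv n R W μ *ᵥ resV h Z) x = fld (covDeriv n R₀ W₀ μ *ᵥ Z) (incl h x) := by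
  have hx₀ : (incl h x).1 + e1 μ ∈ R₀ := h hx
  rw [fld_covDeriv_mulVec_of_mem n W _ hx, fld_covDeriv_mulVec_of_mem n W₀ _ hx₀, fld_resV, fld_resV,
    ← hW x ⟨x.1 + e1 μ, hx⟩]
  rfl

/-- no bond of `Ω`, no derivative. [cite: Balaban1983RegularityDecay, p. 572 (1.3)] -/
theorem fld_covDeriv_resV_of_not_mem (μ : Fin (d + 1)) (Z : ↥R₀ × ι → ℝ) (x : ↥R) (hx : x.1 + e1 μ ∉ R) :
    fld (covDeriv n R W μ *ᵥ resV h Z) x = 0 :=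
  fld_covDeriv_mulVec_of_not_mem n W _ hx

include hW in
/-- **`|(D^Ω_μ (Z|_Ω))(x)|² ≤ |(D^{Ω₀}_μ Z)(x)|²` AT EVERY SITE OF `Ω`**. [cite: Balaban1983RegularityDecay, p. 572 (1.3)] -/
theorem fld_covDeriv_resV_sq_le (μ : Fin (d + 1)) (Z : ↥R₀ × ι → ℝ) (x : ↥R) :
    fld (covDeriv n R W μ *ᵥ resV h Z) x ⬝ᵥ fld (covDeriv n R W μ *ᵥ resV h Z) x
      ≤ fld (covDeriv n R₀ W₀ μ *ᵥ Z) (incl h x) ⬝ᵥ fld (covDeriv n R₀ W₀ μ *ᵥ Z) (incl h x) := by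
  by_cases hx : x.1 + e1 μ ∈ R
  · rw [fld_covDeriv_resV_of_mem n h W₀ W hW μ Z x hx]
  · rw [fld_covDeriv_resV_of_not_mem n h W μ Z x hx, zero_dotProduct]
    exact dotProduct_self_nonneg' _

include hW in
/-- **DERIVATIVE EXCHANGE ON THE LEFT**: `⟨f, D^Ω_μ(Z|_Ω)⟩_Ω = ⟨ext(offL f), D^{Ω₀}_μ Z⟩_{Ω₀}`.
[cite: Balaban1983RegularityDecay, p. 572 (1.3); p. 581 Corollary 2.3] -/
theorem dot_covDeriv_resV (μ : Fin (d + 1)) (f : ↥R × ι → ℝ) (Z : ↥R₀ × ι → ℝ) :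
    f ⬝ᵥ (covDeriv n R W μ *ᵥ resV h Z) = extV R₀ (offL R₀ μ f) ⬝ᵥ (covDeriv n R₀ W₀ μ *ᵥ Z) := by
  rw [extV_dotProduct h, dotProduct_eq_sum_fld, dotProduct_eq_sum_fld]
  refine Finset.sum_congr rfl fun x _ => ?_
  rw [fld_resV]
  by_cases hx : x.1 + e1 μ ∈ R
  · rw [fld_covDeriv_resV_of_mem n h W₀ W hW μ Z x hx, fld_offL_of_not μ f x fun hh => hh.2 hx]
  · rw [fld_covDeriv_resV_of_not_mem n h W μ Z x hx, dotProduct_zero]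
    by_cases hx₀ : x.1 + e1 μ ∈ R₀
    · rw [fld_offL_of_mem μ f x hx₀ hx, zero_dotProduct]
    · rw [fld_covDeriv_mulVec_of_not_mem n W₀ Z (x := incl h x) hx₀, dotProduct_zero]

include hW in
/-- **DERIVATIVE EXCHANGE ON THE RIGHT**: `⟨Z, ext(D^{Ω*}_ν g)⟩_{Ω₀} = ⟨Z, D^{Ω₀*}_ν ext(offL g)⟩_{Ω₀}`.
[cite: Balaban1983RegularityDecay, p. 572 (1.3); p. 581 Corollary 2.3] -/
theorem dot_extV_covDeriv_transpose (ν : Fin (d + 1)) (Z : ↥R₀ × ι → ℝ) (g : ↥R × ι → ℝ) :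
    Z ⬝ᵥ extV R₀ ((covDeriv n R W ν)ᵀ *ᵥ g) = Z ⬝ᵥ ((covDeriv n R₀ W₀ ν)ᵀ *ᵥ extV R₀ (offL R₀ ν g)) := by
  rw [dotProduct_extV h, Matrix.dotProduct_mulVec, Matrix.vecMul_transpose, Matrix.dotProduct_mulVec,
    Matrix.vecMul_transpose, dotProduct_comm, dot_covDeriv_resV n h W₀ W hW ν g Z, dotProduct_comm]

end Deriv

/-! ## §6  Symmetry of the operator (1.6); the identities for [B4]'s regions -/

section Symm

variable {d : ℕ} {ι : Type*} [Fintype ι] [DecidableEq ι]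

/-- the covariant Laplacian is symmetric. [folklore] -/
theorem covLap_transpose {X : Type*} [Fintype X] [DecidableEq X] (c : X → X → ℝ) (W : X → X → Matrix ι ι ℝ) :
    (covLap c W)ᵀ = covLap c W := by
  unfold covLap
  rw [Matrix.transpose_sum]
  refine Finset.sum_congr rfl fun x _ => ?_
  rw [Matrix.transpose_sum]
  refine Finset.sum_congr rfl fun y _ => ?_
  rw [Matrix.transpose_smul, Matrix.transpose_mul, Matrix.transpose_transpose]

omit [DecidableEq ι] in
/-- `P_k = Q_k^*Q_k` is symmetric. [folklore] -/
theorem projOp_transpose {X Y : Type*} [Fintype Y] (q : Y → X → ℝ) (T : Y → X → Matrix ι ι ℝ) :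
    (projOp q T)ᵀ = projOp q T := by
  unfold projOp
  rw [Matrix.transpose_mul, Matrix.transpose_transpose]

variable (F : OrthFlow ι) (e : ℝ) {n : ℕ} (hn : 1 ≤ n) (a m2 : ℝ) {Ωc Ω₀c : Finset (Fin (d + 1) → ℤ)}
  (hΩ : Ωc ⊆ Ω₀c) (Ac : (Fin (d + 1) → ℤ) → Fin (d + 1) → ℝ)

/-- **THE OPERATOR (1.6) IS SYMMETRIC** (hence so is the Green's function `G_k(Ω,A)`).
[cite: Balaban1983RegularityDecay, p. 572 (1.6)] -/
theorem regionOp_transpose (Ωc : Finset (Fin (d + 1) → ℤ)) :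
    (regionOp F e hn a m2 Ωc Ac)ᵀ = regionOp F e hn a m2 Ωc Ac := by
  rw [regionOp_eq, Matrix.transpose_add, Matrix.transpose_add, Matrix.transpose_smul, Matrix.transpose_smul,
    Matrix.transpose_one, covLap_transpose, projOp_transpose]

/-- `G_k(Ω,A)` is symmetric. [cite: Balaban1983RegularityDecay, p. 572 (1.6)] -/
theorem green_transpose (Ωc : Finset (Fin (d + 1) → ℤ)) :
    ((regionOp F e hn a m2 Ωc Ac)⁻¹)ᵀ = (regionOp F e hn a m2 Ωc Ac)⁻¹ := by
  rw [Matrix.transpose_nonsing_inv, regionOp_transpose]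

/-- `⟨ext f, G_k(Ω₀,A)Z⟩_{Ω₀} = ⟨(G_k(Ω₀,A) ext f)|_Ω, Z|_Ω⟩`-type transposition: `⟨Φ, G Ψ⟩ = ⟨G Φ, Ψ⟩` for the
symmetric Green's function. [cite: Balaban1983RegularityDecay, p. 572 (1.6)] -/
theorem dot_green_mulVec (Ωc : Finset (Fin (d + 1) → ℤ)) (Φ Ψ : ↥(fineDom n Ωc) × ι → ℝ) :
    Φ ⬝ᵥ ((regionOp F e hn a m2 Ωc Ac)⁻¹ *ᵥ Ψ) = ((regionOp F e hn a m2 Ωc Ac)⁻¹ *ᵥ Φ) ⬝ᵥ Ψ := by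
  rw [Matrix.dotProduct_mulVec, ← Matrix.vecMul_transpose, green_transpose]

include hΩ in
/-- **DERIVATIVE EXCHANGE ON THE LEFT for [B4]'s regions**: `⟨f, D^{η,Ω}_{A,μ}(Z|_Ω)⟩ = ⟨ext(offL f), D^{η,Ω₀}_{A,μ}Z⟩`.
[cite: Balaban1983RegularityDecay, p. 572 (1.3); p. 581 Corollary 2.3] -/
theorem dot_regionDeriv_resV (μ : Fin (d + 1)) (f : ↥(fineDom n Ωc) × ι → ℝ) (Z : ↥(fineDom n Ω₀c) × ι → ℝ) :
    f ⬝ᵥ (regionDeriv F e n Ωc Ac μ *ᵥ resV (fineDom_mono hn hΩ) Z)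
      = extV (fineDom n Ω₀c) (offL (fineDom n Ω₀c) μ f) ⬝ᵥ (regionDeriv F e n Ω₀c Ac μ *ᵥ Z) :=
  dot_covDeriv_resV n (fineDom_mono hn hΩ) (lnk F e n Ω₀c Ac) (lnk F e n Ωc Ac) (fun _ _ => rfl) μ f Z

include hn hΩ in
/-- **DERIVATIVE EXCHANGE ON THE RIGHT for [B4]'s regions**:
`⟨Z, ext(D^{η,Ω*}_{A,ν}g)⟩ = ⟨Z, D^{η,Ω₀*}_{A,ν} ext(offL g)⟩`. [cite: Balaban1983RegularityDecay, p. 572 (1.3); p. 581 Corollary 2.3] -/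
theorem dot_extV_regionDeriv_transpose (ν : Fin (d + 1)) (Z : ↥(fineDom n Ω₀c) × ι → ℝ)
    (g : ↥(fineDom n Ωc) × ι → ℝ) :
    Z ⬝ᵥ extV (fineDom n Ω₀c) ((regionDeriv F e n Ωc Ac ν)ᵀ *ᵥ g)
      = Z ⬝ᵥ ((regionDeriv F e n Ω₀c Ac ν)ᵀ *ᵥ extV (fineDom n Ω₀c) (offL (fineDom n Ω₀c) ν g)) :=
  dot_extV_covDeriv_transpose n (fineDom_mono hn hΩ) (lnk F e n Ω₀c Ac) (lnk F e n Ωc Ac) (fun _ _ => rfl) ν Z g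

include hΩ in
/-- **`|(D^{η,Ω}_{A,μ}(Z|_Ω))(x)|² ≤ |(D^{η,Ω₀}_{A,μ}Z)(x)|²`** at every site of `Ω`.
[cite: Balaban1983RegularityDecay, p. 572 (1.3)] -/
theorem fld_regionDeriv_resV_sq_le (μ : Fin (d + 1)) (Z : ↥(fineDom n Ω₀c) × ι → ℝ) (x : ↥(fineDom n Ωc)) :
    fld (regionDeriv F e n Ωc Ac μ *ᵥ resV (fineDom_mono hn hΩ) Z) x
        ⬝ᵥ fld (regionDeriv F e n Ωc Ac μ *ᵥ resV (fineDom_mono hn hΩ) Z) x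
      ≤ fld (regionDeriv F e n Ω₀c Ac μ *ᵥ Z) (incl (fineDom_mono hn hΩ) x)
        ⬝ᵥ fld (regionDeriv F e n Ω₀c Ac μ *ᵥ Z) (incl (fineDom_mono hn hΩ) x) :=
  fld_covDeriv_resV_sq_le n (fineDom_mono hn hΩ) (lnk F e n Ω₀c Ac) (lnk F e n Ωc Ac) (fun _ _ => rfl) μ Z x

include hΩ in
/-- **THE PAIRING FORM OF THE CUTOFF REPRESENTATION**: for `θ = 1` on the boundary layer, `u = G_k(Ω,A)g`,
`w = θu`:  `⟨f, δG_k(Ω,Ω₀,A)g⟩ = ⟨f, w⟩ − ⟨(G_k(Ω₀,A) ext f)|_Ω, H_k(Ω,A)w⟩`.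
[cite: Balaban1983RegularityDecay, p. 573 (1.11); p. 581 Corollary 2.3] -/
theorem dot_dGv_eq_cutoff {γ : ℝ} (hγ : 0 < γ)
    (hco : ∀ v, γ * (v ⬝ᵥ v) ≤ v ⬝ᵥ (regionOp F e hn a m2 Ωc Ac *ᵥ v))
    (hco₀ : ∀ v, γ * (v ⬝ᵥ v) ≤ v ⬝ᵥ (regionOp F e hn a m2 Ω₀c Ac *ᵥ v))
    (θ : ↥(fineDom n Ωc) → ℝ) (hθ : ∀ x ∈ bdR (fineDom n Ωc) (fineDom n Ω₀c), θ x = 1)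
    (f g : ↥(fineDom n Ωc) × ι → ℝ) :
    f ⬝ᵥ dGv (fineDom_mono hn hΩ) (regionOp F e hn a m2 Ωc Ac)⁻¹ (regionOp F e hn a m2 Ω₀c Ac)⁻¹ g
      = f ⬝ᵥ smulF θ ((regionOp F e hn a m2 Ωc Ac)⁻¹ *ᵥ g)
        - resV (fineDom_mono hn hΩ) ((regionOp F e hn a m2 Ω₀c Ac)⁻¹ *ᵥ extV (fineDom n Ω₀c) f)
          ⬝ᵥ (regionOp F e hn a m2 Ωc Ac *ᵥ smulF θ ((regionOp F e hn a m2 Ωc Ac)⁻¹ *ᵥ g)) := by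
  rw [dGv_eq_cutoff F e hn a m2 hΩ Ac hγ hco hco₀ θ hθ g, dotProduct_sub, ← extV_dotProduct (fineDom_mono hn hΩ) f,
    dot_green_mulVec, dotProduct_extV]

end Symm

end

end Literature.MathematicalPhysics.QuantumFieldTheory.Balaban1983to89.B4Cor23RegionDeltaAlg
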